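import Summits.CriticalPhenomena.SAWScalingLimit.Theses.SAWConePseudogroup
import Summits.CriticalPhenomena.SAWScalingLimit.Theses.SAWConfRestriction
import Summits.CriticalPhenomena.SAWScalingLimit.Theses.SAWBrownianDomination
import Summits.CriticalPhenomena.SAWScalingLimit.Theses.SAWTowerCount
import Summits.CriticalPhenomena.SAWScalingLimit.Theses.SAWTensorRG
import Summits.CriticalPhenomena.SAWScalingLimit.Theorems.SAWTensorRGRestrictionOfLimitStubRestrictionOfSqueeze
import Summits.CriticalPhenomena.SAWScalingLimit.Theorems.SAWTensorRGRestrictionOfLimitStubRadoSqueezeFamily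
import Literature.Probability.RandomPlanarGeometry.CovariantSqueezeContinuity

/-!
# `RestrictionOfLimit` is a THEOREM for a conformally covariant scaling limit

Support file (`--supports stmt-CriticalPhenomena-0773`, registered stub `stub_restrictionOfLimitOfConfCovLimit`,
composition 4 of the skeleton `Cruxes/RestrictionOfLimit/Lines/birth.lean`) of the line `birth` for the crux
`RestrictionOfLimit` (stmt-CriticalPhenomena-0773; shared verbatim by the routes SAWConePseudogroup r7 /
SAWConfRestriction r4 / SAWBrownianDomination r5 / SAWTowerCount support / SAWTensorRG r5).

**Headline.** If `P` is the scaling limit of the critical square-lattice SAW (`SAW.IsScalingLimitFamily P`) and `P`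
is conformally covariant (`ChordalFamily.IsConformallyCovariant`), then `P` has Lawler–Schramm–Werner's two-sided
restriction property `ChordalFamily.IsRestriction` for EVERY pair of Dobrushin domains `D' ⊆ D` with the same
marked points — no hull / smoothness / agreement-near-the-marks proviso
(`isRestriction_of_isConformallyCovariant`). This is LSW, *On the scaling limit of planar self-avoiding walk*
(Proc. Sympos. Pure Math. 72 (2004), arXiv:math/0204277) §3.4.5, "the measures `μ_saw(z,w;D,N)` satisfy the
restriction property … Hence, the limit measure, assuming it exists, must satisfy this property", made a theorem
under the paper's own standing assumption of §2/§4.1 that the limit is conformally covariant.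

**Proof.** Everything but one line was LANDED by the earlier leads of this crux, in this namespace:
* GENERIC RESTRICTION + GLUE `stub_restrictionOfSqueeze` (p154640): along a separated exhausting outer squeeze
  `E t ↓ D'` inside `D` with `P (E t) ⇒ P D'` weakly, the identity holds for `(D, D')` (the exact lattice identity,
  domination and interior avoidance make the identity fail for at most countably many `t`; continuity from above
  and uniqueness of weak limits finish);
* RADÓ SQUEEZES EXIST `stub_radoSqueezeFamily` (p167791): every pair admits such a squeeze together with
  closed-disc uniformizers `Φ t → Φ` converging uniformly on the closed unit disc (plane topology + Radó);
* and the Literature lemma `IsConformallyCovariant.tendsto_integral_of_discUniformizers`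
  (`CovariantSqueezeContinuity.lean`): a conformally covariant chordal family IS weakly continuous along
  closed-disc uniformizers converging uniformly on the closed disc (`P (E t) = (Φ t)_* P B` for a unit-disc
  parameter domain `B`, dominated convergence on the compact traces).

**Consequences for the five routes (all kernel-checked below).** The SAW scaling limit is unique
(`SAW.IsScalingLimitFamily.unique`), so the EXISTENCE of one conformally covariant scaling limit — the shared crux
`ConfCovLimit` (stmt-CriticalPhenomena-0771) of SAWConfRestriction / SAWBrownianDomination / SAWTowerCount, the
conclusion of `LimitGlue` in SAWTensorRG, and `LimitExists` + `CovarianceUpgrade`'s output in SAWConePseudogroup —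
implies `RestrictionOfLimit` for every `P` in its binder (`stub_restrictionOfLimitOfConfCovLimit` and the four
sibling copies). In each of the five deciding theorems `closes` the covariance of `P` is ALREADY IN SCOPE at the
point where the item `RestrictionOfLimit` is invoked; the corollaries `closes_without_restrictionOfLimit_*` re-prove
each deciding theorem with that hypothesis removed. So, as far as these five routes are concerned, the item
stmt-CriticalPhenomena-0773 is REDUNDANT: it is implied by items the routes carry anyway. (As TYPED — for an
abstract, possibly non-covariant limit — it remains equivalent to outer domain continuity of the SAW limit,
composition 2/3 of the skeleton, i.e. to the crux `DiscContinuity`, stmt-CriticalPhenomena-6755.)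

No named fact is used; axioms `propext`, `Classical.choice`, `Quot.sound`.
-/

noncomputable section

open MeasureTheory Filter Topology Set Metric
open scoped ENNReal NNReal BoundedContinuousFunction
open Literature.Probability.RandomPlanarGeometry Literature.Probability.LatticeModels

namespace Summit.CriticalPhenomena.SAWScalingLimit.Theorems.RestrictionOfLimit.Birth

/-! ### The core: covariance ⇒ restriction, for the SAW scaling limit -/

/-- **A conformally covariant SAW scaling limit has the two-sided restriction property** for every pair of
Dobrushin domains `D' ⊆ D` with the same marked points. Proof: the Radó squeeze of `(D, D')`
(`stub_radoSqueezeFamily`), weak continuity of the covariant family along it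
(`IsConformallyCovariant.tendsto_integral_of_discUniformizers`), and the glue `stub_restrictionOfSqueeze`.
[cite: LawlerSchrammWerner2004SAW, §3.4.5] -/
theorem isRestriction_of_isConformallyCovariant {P : ChordalFamily} (hP : SAW.IsScalingLimitFamily P)
    (hcov : P.IsConformallyCovariant) : P.IsRestriction := by
  intro D D' hsub h0 h1 T hTm
  obtain ⟨E, hN, hS, hX, Φt, Φ, hΦt, hΦ, hmk, h0', h1', hunif⟩ := stub_radoSqueezeFamily D D' hsub h0 h1
  exact stub_restrictionOfSqueeze P hP D D' E hN hS hX
    (fun f => hcov.tendsto_integral_of_discUniformizers hP.1 hΦt hΦ hmk h0' h1' hunif f) T hTm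

/-- **Covariance transfers across the binder by uniqueness of the scaling limit**: if SOME scaling-limit family
is conformally covariant, EVERY scaling-limit family is (they are equal, `SAW.IsScalingLimitFamily.unique`).
[folklore] -/
theorem isConformallyCovariant_of_exists {P : ChordalFamily} (hP : SAW.IsScalingLimitFamily P)
    (h : ∃ P₀ : ChordalFamily, SAW.IsScalingLimitFamily P₀ ∧ P₀.IsConformallyCovariant) :
    P.IsConformallyCovariant := by
  obtain ⟨P₀, hP₀, hcov⟩ := h
  rw [hP.unique hP₀]
  exact hcov

/-- **Restriction across the binder**: if some scaling-limit family is conformally covariant, every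
scaling-limit family has the restriction property. [folklore] -/
theorem isRestriction_of_exists_covariant {P : ChordalFamily} (hP : SAW.IsScalingLimitFamily P)
    (h : ∃ P₀ : ChordalFamily, SAW.IsScalingLimitFamily P₀ ∧ P₀.IsConformallyCovariant) :
    P.IsRestriction :=
  isRestriction_of_isConformallyCovariant hP (isConformallyCovariant_of_exists hP h)

/-! ### Registered stub: `ConfCovLimit → RestrictionOfLimit` (composition 4 of the skeleton) -/

/-- **Registered stub `stub_restrictionOfLimitOfConfCovLimit` — `ConfCovLimit → RestrictionOfLimit`** (both in
their SAWConfRestriction copies, r2 and r4 of that route): the existence of a conformally covariant scaling limit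
of the critical SAW (stmt-CriticalPhenomena-0771) implies LSW's restriction property for every scaling-limit family
and every pair `D' ⊆ D` with the same marked points (stmt-CriticalPhenomena-0773). A CONDITIONAL result (it credits
nothing to stmt-0773 by itself); its point is that r4 is implied by r2 inside the route.
[cite: LawlerSchrammWerner2004SAW, §3.4.5] -/
theorem stub_restrictionOfLimitOfConfCovLimit :
    Summit.CriticalPhenomena.SAWScalingLimit.Theses.SAWConfRestriction.ConfCovLimit →
      Summit.CriticalPhenomena.SAWScalingLimit.Theses.SAWConfRestriction.RestrictionOfLimit := by
  rintro ⟨P₀, hch₀, hlim₀, hcov₀⟩ P hch hlim D D' hsub h0 h1 T hTm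
  exact isRestriction_of_exists_covariant ⟨hch, hlim⟩ ⟨P₀, ⟨hch₀, hlim₀⟩, hcov₀⟩ D D' hsub h0 h1 T hTm

/-- `ConfCovLimit → RestrictionOfLimit`, SAWBrownianDomination copies (r4 → r5 of that route). [folklore] -/
theorem restrictionOfLimit_brownianDomination_of_confCovLimit
    (h : Summit.CriticalPhenomena.SAWScalingLimit.Theses.SAWBrownianDomination.ConfCovLimit) :
    Summit.CriticalPhenomena.SAWScalingLimit.Theses.SAWBrownianDomination.RestrictionOfLimit :=
  stub_restrictionOfLimitOfConfCovLimit h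

/-- `ConfCovLimit → RestrictionOfLimit`, SAWTowerCount copies (r? → support of that route). [folklore] -/
theorem restrictionOfLimit_towerCount_of_confCovLimit
    (h : Summit.CriticalPhenomena.SAWScalingLimit.Theses.SAWTowerCount.ConfCovLimit) :
    Summit.CriticalPhenomena.SAWScalingLimit.Theses.SAWTowerCount.RestrictionOfLimit :=
  stub_restrictionOfLimitOfConfCovLimit h

/-- `ConfCovLimit → RestrictionOfLimit`, SAWConePseudogroup copy of the conclusion (r7 of that route).
[folklore] -/
theorem restrictionOfLimit_conePseudogroup_of_confCovLimit
    (h : Summit.CriticalPhenomena.SAWScalingLimit.Theses.SAWConfRestriction.ConfCovLimit) :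
    Summit.CriticalPhenomena.SAWScalingLimit.Theses.SAWConePseudogroup.RestrictionOfLimit :=
  stub_restrictionOfLimitOfConfCovLimit h

/-- `ConfCovLimit → RestrictionOfLimit`, SAWTensorRG copy of the conclusion (r5 of that route). [folklore] -/
theorem restrictionOfLimit_tensorRG_of_confCovLimit
    (h : Summit.CriticalPhenomena.SAWScalingLimit.Theses.SAWConfRestriction.ConfCovLimit) :
    Summit.CriticalPhenomena.SAWScalingLimit.Theses.SAWTensorRG.RestrictionOfLimit :=
  stub_restrictionOfLimitOfConfCovLimit h

/-! ### Route SAWConePseudogroup: r7 from the route's own covariance chain -/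

/-- **SAWConePseudogroup: `RestrictionOfLimit` (r7) follows from the route's other items** — `LimitExists`,
`LatticeSimilarityOfLimit`, `ContinuityOfLimit`, `EndpointApproxExists`, `PowerMapUniversality`,
`PseudogroupDensity`, `CovarianceUpgrade` — exactly the chain by which its deciding theorem `closes` obtains
`P.IsConformallyCovariant` before it invokes r7. [folklore] -/
theorem restrictionOfLimit_conePseudogroup_of_items
    (hLim : Summit.CriticalPhenomena.SAWScalingLimit.Theses.SAWConePseudogroup.LimitExists)
    (hSim : Summit.CriticalPhenomena.SAWScalingLimit.Theses.SAWConePseudogroup.LatticeSimilarityOfLimit)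
    (hCont : Summit.CriticalPhenomena.SAWScalingLimit.Theses.SAWConePseudogroup.ContinuityOfLimit)
    (hEnd : Summit.CriticalPhenomena.SAWScalingLimit.Theses.SAWConePseudogroup.EndpointApproxExists)
    (hPow : Summit.CriticalPhenomena.SAWScalingLimit.Theses.SAWConePseudogroup.PowerMapUniversality)
    (hDens : Summit.CriticalPhenomena.SAWScalingLimit.Theses.SAWConePseudogroup.PseudogroupDensity)
    (hUp : Summit.CriticalPhenomena.SAWScalingLimit.Theses.SAWConePseudogroup.CovarianceUpgrade) :
    Summit.CriticalPhenomena.SAWScalingLimit.Theses.SAWConePseudogroup.RestrictionOfLimit := by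
  obtain ⟨P₀, hch₀, hlim₀⟩ := hLim
  have hcov : P₀.IsConformallyCovariant :=
    hUp hEnd hPow hDens P₀ hch₀ hlim₀ (hSim hEnd P₀ hch₀ hlim₀) (hCont P₀ hch₀ hlim₀)
  intro P hch hlim D D' hsub h0 h1 T hTm
  exact isRestriction_of_exists_covariant ⟨hch, hlim⟩ ⟨P₀, ⟨hch₀, hlim₀⟩, hcov⟩ D D' hsub h0 h1 T hTm

/-! ### Route SAWTensorRG: r5 from the output of `LimitGlue` -/

/-- **SAWTensorRG: `RestrictionOfLimit` (r5) follows from the route's other items** — `EndpointApproxExists`,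
`ConformalAvoidance`, `EventualTight`, `SimpleSubseqLimits` and the glue `LimitGlue` (fed the PROVED tree theorems
`CurveClass.polishSpace_holds`, `MarkedDomain.exists_isChordalUniformizing_holds` and the proved item
`AvoidanceDeterminesLaw_holds`), whose conclusion is a conformally covariant scaling limit. [folklore] -/
theorem restrictionOfLimit_tensorRG_of_limitGlue
    (hE : Summit.CriticalPhenomena.SAWScalingLimit.Theses.SAWTensorRG.EndpointApproxExists)
    (hCA : Summit.CriticalPhenomena.SAWScalingLimit.Theses.SAWTensorRG.ConformalAvoidance)
    (hT : Summit.CriticalPhenomena.SAWScalingLimit.Theses.SAWTensorRG.EventualTight)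
    (hS : Summit.CriticalPhenomena.SAWScalingLimit.Theses.SAWTensorRG.SimpleSubseqLimits)
    (hG : Summit.CriticalPhenomena.SAWScalingLimit.Theses.SAWTensorRG.LimitGlue) :
    Summit.CriticalPhenomena.SAWScalingLimit.Theses.SAWTensorRG.RestrictionOfLimit := by
  obtain ⟨P₀, hch₀, hlim₀, hcov₀⟩ :=
    hG CurveClass.polishSpace_holds MarkedDomain.exists_isChordalUniformizing_holds hE hCA hT hS
      Summit.CriticalPhenomena.SAWScalingLimit.Theses.SAWTensorRG.AvoidanceDeterminesLaw_holds
  intro P hch hlim D D' hsub h0 h1 T hTm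
  exact isRestriction_of_exists_covariant ⟨hch, hlim⟩ ⟨P₀, ⟨hch₀, hlim₀⟩, hcov₀⟩ D D' hsub h0 h1 T hTm

/-! ### The five deciding theorems, re-proved WITHOUT the item `RestrictionOfLimit` -/

/-- **SAWConfRestriction closes without r4**: `ConfCovLimit → SimpleOfLimit → LSWCharacterisation → SAWScalingLimit`
(the route's `closes` with its hypothesis `RestrictionOfLimit` supplied by `stub_restrictionOfLimitOfConfCovLimit`).
[folklore] -/
theorem closes_without_restrictionOfLimit_confRestriction
    (hCC : Summit.CriticalPhenomena.SAWScalingLimit.Theses.SAWConfRestriction.ConfCovLimit)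
    (hS : Summit.CriticalPhenomena.SAWScalingLimit.Theses.SAWConfRestriction.SimpleOfLimit)
    (hLSW : Summit.CriticalPhenomena.SAWScalingLimit.Theses.SAWConfRestriction.LSWCharacterisation) :
    _root_.SAWScalingLimit :=
  Summit.CriticalPhenomena.SAWScalingLimit.Theses.SAWConfRestriction.closes hCC
    (stub_restrictionOfLimitOfConfCovLimit hCC) hS hLSW

/-- **SAWBrownianDomination closes without r5.** [folklore] -/
theorem closes_without_restrictionOfLimit_brownianDomination
    (hUD : Summit.CriticalPhenomena.SAWScalingLimit.Theses.SAWBrownianDomination.UniformDomination)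
    (hNT : Summit.CriticalPhenomena.SAWScalingLimit.Theses.SAWBrownianDomination.NeverTouch)
    (hCC : Summit.CriticalPhenomena.SAWScalingLimit.Theses.SAWBrownianDomination.ConfCovLimit)
    (hSD : Summit.CriticalPhenomena.SAWScalingLimit.Theses.SAWBrownianDomination.SharpDomination)
    (hLSW : Summit.CriticalPhenomena.SAWScalingLimit.Theses.SAWBrownianDomination.LSWRestrictionFact83)
    (hSS : Summit.CriticalPhenomena.SAWScalingLimit.Theses.SAWBrownianDomination.SubseqSimple)
    (hAE : Summit.CriticalPhenomena.SAWScalingLimit.Theses.SAWBrownianDomination.ApproxExists) :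
    _root_.SAWScalingLimit :=
  Summit.CriticalPhenomena.SAWScalingLimit.Theses.SAWBrownianDomination.closes hUD hNT hCC
    (restrictionOfLimit_brownianDomination_of_confCovLimit hCC) hSD hLSW hSS hAE

/-- **SAWTowerCount closes without its `RestrictionOfLimit` support item.** [folklore] -/
theorem closes_without_restrictionOfLimit_towerCount
    (hCM : Summit.CriticalPhenomena.SAWScalingLimit.Theses.SAWTowerCount.CorridorMassFiveEighths)
    (hEI : Summit.CriticalPhenomena.SAWScalingLimit.Theses.SAWTowerCount.ExponentIdentifies)
    (hCC : Summit.CriticalPhenomena.SAWScalingLimit.Theses.SAWTowerCount.ConfCovLimit)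
    (hTame : Summit.CriticalPhenomena.SAWScalingLimit.Theses.SAWTowerCount.TameOfLimit) :
    _root_.SAWScalingLimit :=
  Summit.CriticalPhenomena.SAWScalingLimit.Theses.SAWTowerCount.closes hCM hEI hCC
    (restrictionOfLimit_towerCount_of_confCovLimit hCC) hTame

/-- **SAWConePseudogroup closes without r7.** [folklore] -/
theorem closes_without_restrictionOfLimit_conePseudogroup
    (hLSW : Summit.CriticalPhenomena.SAWScalingLimit.Theses.SAWConePseudogroup.LSWSimpleRestriction)
    (hLim : Summit.CriticalPhenomena.SAWScalingLimit.Theses.SAWConePseudogroup.LimitExists)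
    (hSimple : Summit.CriticalPhenomena.SAWScalingLimit.Theses.SAWConePseudogroup.SimpleOfLimit)
    (hSim : Summit.CriticalPhenomena.SAWScalingLimit.Theses.SAWConePseudogroup.LatticeSimilarityOfLimit)
    (hCont : Summit.CriticalPhenomena.SAWScalingLimit.Theses.SAWConePseudogroup.ContinuityOfLimit)
    (hEnd : Summit.CriticalPhenomena.SAWScalingLimit.Theses.SAWConePseudogroup.EndpointApproxExists)
    (hPow : Summit.CriticalPhenomena.SAWScalingLimit.Theses.SAWConePseudogroup.PowerMapUniversality)
    (hDens : Summit.CriticalPhenomena.SAWScalingLimit.Theses.SAWConePseudogroup.PseudogroupDensity)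
    (hUp : Summit.CriticalPhenomena.SAWScalingLimit.Theses.SAWConePseudogroup.CovarianceUpgrade) :
    _root_.SAWScalingLimit :=
  Summit.CriticalPhenomena.SAWScalingLimit.Theses.SAWConePseudogroup.closes hLSW hLim
    (restrictionOfLimit_conePseudogroup_of_items hLim hSim hCont hEnd hPow hDens hUp) hSimple hSim hCont hEnd
    hPow hDens hUp

/-- **SAWTensorRG closes without r5** (the engine milestones `IsotropicCorrelationLength`, `TurningInvariance`
and the item `Assembly` are passengers of `closes`, carried unchanged). [folklore] -/
theorem closes_without_restrictionOfLimit_tensorRG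
    (hCA : Summit.CriticalPhenomena.SAWScalingLimit.Theses.SAWTensorRG.ConformalAvoidance)
    (hIso : Summit.CriticalPhenomena.SAWScalingLimit.Theses.SAWTensorRG.IsotropicCorrelationLength)
    (hS : Summit.CriticalPhenomena.SAWScalingLimit.Theses.SAWTensorRG.SimpleSubseqLimits)
    (hT : Summit.CriticalPhenomena.SAWScalingLimit.Theses.SAWTensorRG.EventualTight)
    (hAv : Summit.CriticalPhenomena.SAWScalingLimit.Theses.SAWTensorRG.AvoidanceDeterminesLaw)
    (hE : Summit.CriticalPhenomena.SAWScalingLimit.Theses.SAWTensorRG.EndpointApproxExists)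
    (hTurn : Summit.CriticalPhenomena.SAWScalingLimit.Theses.SAWTensorRG.TurningInvariance)
    (hG : Summit.CriticalPhenomena.SAWScalingLimit.Theses.SAWTensorRG.LimitGlue)
    (hLSW : Summit.CriticalPhenomena.SAWScalingLimit.Theses.SAWTensorRG.LSWCharacterisation)
    (hA : Summit.CriticalPhenomena.SAWScalingLimit.Theses.SAWTensorRG.Assembly) :
    _root_.SAWScalingLimit :=
  Summit.CriticalPhenomena.SAWScalingLimit.Theses.SAWTensorRG.closes hCA hIso hS
    (restrictionOfLimit_tensorRG_of_limitGlue hE hCA hT hS hG) hT hAv hE hTurn hG hLSW hA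

end Summit.CriticalPhenomena.SAWScalingLimit.Theorems.RestrictionOfLimit.Birth

end
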